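import Summits.Ventures.PercRepro.Night2LocalRuleLossFair

/-!
# PercRepro — the local form, hence the diagonal of C-025, from ONE per-loss inequality (night-2, gen 18)

`LossFairCond` is the per-loss inequality of the fair-share loss routing (`Night2LocalRuleLossFair`) asked at every
rank-`(q+1)` flat `G` with `|E ∖ G| ≤ q` of every finite matroid: for every thin member `B` below `G` and every
`z ∈ G ∖ cl B`, `loss B z ≤ rhoL B z · lossIncome B z`.  With the thin theorem `localShadowHall_of_thin` for
`|E ∖ G| ≥ q + 1` it gives the whole local form `LocalShadowC025` (**`localShadowC025_of_lossFairCond`**), hence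
the diagonal shadow-Hall form at every `q` and the body of C-025 at every `(q + 2, q)` on every finite matroid
(**`shadowHall_diag_of_lossFairCond`**, **`c025_diag_of_lossFairCond`**).  `LossFairCond` is a conjecture of
record of the lane (proofs/NIGHT-2-g18.md §6): it holds with ratio `≥ 8/3` on every instance tested — the
catalogue of all matroids on `≤ 8` elements at every `(q, G)`, the eight open cells of the `(7,5)` row, the rigid
cell at `q = 5 … 10`, the nested lines and the structured adversaries of gen 17.
-/

namespace PercRepro.Shadow

open Finset PerFlat ThmH

/-- **The per-loss inequality of the fair-share loss routing, at every flat with `|E ∖ G| ≤ q` of every finite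
matroid** (a conjecture of record; see the module docstring). -/
def LossFairCond : Prop :=
  ∀ {α : Type} [DecidableEq α] (M : Matroid α) [M.Finite] (q : ℕ) (G : Finset α),
    G ∈ flatsQ M (q + 1) → (gr M \ G).card ≤ q →
    ∀ B ∈ thinMembers M q G, ∀ z ∈ G \ clF M B,
      loss M q G B z ≤ rhoL M q G B z * lossIncome M q G B z

/-- **The local form from the per-loss inequality.** -/
theorem localShadowC025_of_lossFairCond (h : LossFairCond) : LocalShadowC025 := by
  intro α _ M _ q G hG
  by_cases hd : (gr M \ G).card ≤ q
  · exact localShadowHall_of_lossFair hG hd (h M q G hG hd)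
  · apply localShadowHall_of_thin hG
    intro B hB hBG
    rw [card_compl_clF_add hG hBG]
    have := one_le_card_sdiff_clF hG hB
    omega

/-- The diagonal shadow-Hall form at every `q` from the per-loss inequality. -/
theorem shadowHall_diag_of_lossFairCond (h : LossFairCond) {α : Type} [DecidableEq α] (M : Matroid α)
    [M.Finite] (q : ℕ) : ShadowHall M (q + 2) q (phiK (q + 2) q) :=
  shadowHall_diag_of_localC025 (localShadowC025_of_lossFairCond h) M q

/-- The body of C-025 at every diagonal `(q + 2, q)` from the per-loss inequality. -/
theorem c025_diag_of_lossFairCond (h : LossFairCond) {α : Type} [DecidableEq α] (M : Matroid α)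
    [M.Finite] (q : ℕ) :
    phiK (q + 2) q * ({A : Set α | A ⊆ M.E ∧ M.eRk A = ((q + 2 : ℕ) : ℕ∞) ∧ M.eRk (M.E \ A) = (q : ℕ∞)}.ncard : ℚ) ≤
      ({A : Set α | A ⊆ M.E ∧ (q : ℕ∞) < M.eRk A ∧ M.eRk A < ((q + 2 : ℕ) : ℕ∞)}.ncard : ℚ) :=
  c025_diag_of_localC025 (localShadowC025_of_lossFairCond h) M q

end PercRepro.Shadow
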